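import Summits.CriticalPhenomena.PercolationContinuityZ3.Theorems.PercNearOneGluingNoHeavyLowerTailAntitheticCycleRuns
import HarnessLib

/-!
# `NoHeavyLowerTail` (stmt-CriticalPhenomena-4575) — antithetic cluster pairs: REFLECTION of a cycle and injectivity of its pairs (THEOREM C, file C1b;
# prim-hp-2 gen 39, HOME/THEOREM-C-cycles.md "LEAN BLUEPRINT")

Support file (`--supports stmt-CriticalPhenomena-4575`, hull-port prover `prim-hp-2`, gen 39).  No definitions, no named facts, no sorries; standard axioms.

The staircase pieces of THEOREM C come in two orientations (cube leg on the `edge 0` side or on the `edge (n−1)` side).  Rather than proving everything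
twice, the second orientation is the first one for the REFLECTED parametrisation `v' i = v (n − i)` of the same cycle:
* `Cyc.reflect_inj`, `Cyc.reflect_per`, `Cyc.edge_reflect` (`edge v' i = edge v (n−1−i)`), `Cyc.edgeSet_reflect` (same edge set), `Cyc.reflect_zero`;
* `Cyc.pre_reflect` / `Cyc.suf_reflect`: the prefix run of the reflected cycle is the suffix run of the original and vice versa;
* `Cyc.edge_inj`: `edge v i = edge v j → i = j` for `i, j < n` (`n ≥ 3`), and `Cyc.mem_edge_image`.
[cite: VandenbergHaggstromKahn2005, §1 p. 3 (open cluster `C_s`)]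
-/

noncomputable section

namespace Summit.CriticalPhenomena.PercolationContinuityZ3.Theorems

open Literature.Probability.Percolation
open scoped Classical

namespace Antithetic

namespace Cyc

variable {V : Type*} {n : ℕ} {v : ℕ → V} (hn : 3 ≤ n) (hinj : ∀ i j, i < n → j < n → v i = v j → i = j) (hper : v n = v 0)
include hn hinj hper

/-- The pairs of a cycle with `n ≥ 3` vertices are pairwise distinct. -/
theorem edge_inj {i j : ℕ} (hi : i < n) (hj : j < n) (h : edge v i = edge v j) : i = j := by
  unfold edge at h
  rcases Sym2.eq_iff.1 h with ⟨h1, h2⟩ | ⟨h1, h2⟩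
  · rcases idx_eq hn hinj hper hi.le hj.le h1 with h' | ⟨-, h'⟩ | ⟨h', -⟩ <;> omega
  · -- v i = v (j+1) and v (i+1) = v j
    rcases idx_eq hn hinj hper hi.le (by omega : j + 1 ≤ n) h1 with h' | ⟨hi0, hj1⟩ | ⟨h', -⟩
    · rcases idx_eq hn hinj hper (by omega : i + 1 ≤ n) hj.le h2 with h'' | ⟨h'', -⟩ | ⟨hi1, hj0⟩ <;> omega
    · rcases idx_eq hn hinj hper (by omega : i + 1 ≤ n) hj.le h2 with h'' | ⟨h'', -⟩ | ⟨hi1, hj0⟩ <;> omega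
    · omega

/-- Membership in an image of `edge`: `edge v i ∈ {edge v j : P j}` iff `P i` (for indices `< n`). -/
theorem mem_edge_image {P : ℕ → Prop} {i : ℕ} (hi : i < n) :
    edge v i ∈ {e : Sym2 V | ∃ j, j < n ∧ P j ∧ e = edge v j} ↔ P i := by
  constructor
  · rintro ⟨j, hj, hP, he⟩
    rwa [edge_inj hn hinj hper hi hj he]
  · exact fun h => ⟨i, hi, h, rfl⟩

omit hn hinj in
/-- The reflected parametrisation is periodic. -/
theorem reflect_per : (fun i => v (n - i)) n = (fun i => v (n - i)) 0 := by
  simp only [Nat.sub_self, Nat.sub_zero, hper]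

omit hn in
/-- The reflected parametrisation is injective on `[0, n)`. -/
theorem reflect_inj : ∀ i j, i < n → j < n → (fun i => v (n - i)) i = (fun i => v (n - i)) j → i = j := by
  intro i j hi hj h
  simp only at h
  by_cases hi0 : i = 0
  · by_cases hj0 : j = 0
    · omega
    · subst hi0
      rw [Nat.sub_zero, hper] at h
      have := hinj 0 (n - j) (by omega) (by omega) h
      omega
  · by_cases hj0 : j = 0
    · subst hj0
      rw [Nat.sub_zero, hper] at h
      have := hinj (n - i) 0 (by omega) (by omega) h
      omega
    · have := hinj (n - i) (n - j) (by omega) (by omega) h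
      omega

omit hn hinj in
/-- The source is fixed by the reflection. -/
theorem reflect_zero : (fun i => v (n - i)) 0 = v 0 := by simp only [Nat.sub_zero, hper]

omit hn hinj hper in
/-- The pairs of the reflected cycle: `edge v' i = edge v (n − 1 − i)` for `i < n`. -/
theorem edge_reflect {i : ℕ} (hi : i < n) : edge (fun i => v (n - i)) i = edge v (n - 1 - i) := by
  unfold edge
  simp only
  rw [show n - (i + 1) = n - 1 - i by omega, show n - i = n - 1 - i + 1 by omega, Sym2.eq_swap]

omit hn hinj hper in
/-- The reflected cycle has the same edge set. -/
theorem edgeSet_reflect : edgeSet n (fun i => v (n - i)) = edgeSet n v := by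
  ext e
  constructor
  · rintro ⟨i, hi, rfl⟩
    exact ⟨n - 1 - i, by omega, edge_reflect hi⟩
  · rintro ⟨i, hi, rfl⟩
    exact ⟨n - 1 - i, by omega, by rw [edge_reflect (by omega)]; congr 1; omega⟩

omit hn hinj hper in
/-- Prefix run of the reflected cycle = suffix run of the original. -/
theorem pre_reflect (ω : Set (Sym2 V)) : pre n (fun i => v (n - i)) ω = suf n v ω := by
  apply le_antisymm
  · -- the first `pre'` reflected pairs are red: these are the last pairs of the original
    by_cases hlt : pre n (fun i => v (n - i)) ω < n
    · refine le_suf ω (pre_le ω) fun j hj => ?_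
      have := red_of_lt_pre ω hj
      rwa [edge_reflect (by omega)] at this
    · have hpn : pre n (fun i => v (n - i)) ω = n := le_antisymm (pre_le ω) (by omega)
      rw [hpn]
      refine le_suf ω le_rfl fun j hj => ?_
      have := red_of_lt_pre (n := n) (v := fun i => v (n - i)) ω (i := j) (by omega)
      rwa [edge_reflect hj] at this
  · refine le_pre ω (suf_le ω) fun i hi => ?_
    rw [edge_reflect (lt_of_lt_of_le hi (suf_le ω))]
    exact red_of_lt_suf ω hi

omit hn hinj hper in
/-- Suffix run of the reflected cycle = prefix run of the original. -/
theorem suf_reflect (ω : Set (Sym2 V)) : suf n (fun i => v (n - i)) ω = pre n v ω := by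
  apply le_antisymm
  · refine le_pre ω (suf_le ω) fun i hi => ?_
    have hs := suf_le (n := n) (v := fun i => v (n - i)) ω
    have := red_of_lt_suf (n := n) (v := fun i => v (n - i)) ω hi
    rwa [edge_reflect (by omega), show n - 1 - (n - 1 - i) = i by omega] at this
  · refine le_suf ω (pre_le ω) fun j hj => ?_
    have hp := pre_le (n := n) (v := v) ω
    rw [edge_reflect (by omega), show n - 1 - (n - 1 - j) = j by omega]
    exact red_of_lt_pre ω hj

end Cyc

end Antithetic

end Summit.CriticalPhenomena.PercolationContinuityZ3.Theorems
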